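import Literature.AlgebraicGeometry.HodgeTheory.SignSymmetricTransvectionMonodromyOneSeed
import Literature.AlgebraicGeometry.HodgeTheory.SignSymmetricCentraliserCommutatorsHodgeGroup
import HarnessLib

/-!
# Sign-symmetric monodromy with fixed centres of unknown sign: identity component and Hodge-group commutators

Family `hodge`, layer `Literature/AlgebraicGeometry/HodgeTheory`; sequel of `SignSymmetricTransvectionMonodromyOneSeed` (§5
`mem_glZariskiClosure_of_signSymmetric_of_eigenCentres`) and of `SignSymmetricCentraliserCommutatorsHodgeGroup` (theorems only).
Written by the prover seat `hodge-nonav-19716-p2` (g9, cell `hodge-nonav`) as brick 2 of «W-ELIM» for crux K1-B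
`VeryGeneralSignCommutatorsInHg` (`Summits/HodgeConjecture/HodgeConjecture/Theses/SignSymmetricPowers.lean`, stmt-HodgeConjecture-19716):
the consumers of "Theorem A" restated WITHOUT Wall's sign rule — the fixed centres need only be `σ`-eigenvectors (automatic,
`eq_or_eq_neg_of_oneParamTransvection_comm`), with at least one fixed centre whenever there are paired centres.

* `mem_glIdentityComponent_of_signSymmetric_of_eigenCentres` — the same conclusion inside `glIdentityComponent Γ` (finite-index
  subgroups contain powers of the generators; verbatim the argument of `mem_glIdentityComponent_of_signSymmetric`);
* `commutator_mem_hodgeGroup_of_signSymmetric_of_eigenCentres` — with `Mon⁰ ⊆ MT`, commutators of the `σ`-centraliser lie in `Hg`.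

References: [Deligne1980] §4.4 (4.4.1)–(4.4.4^α); [CarlsonMullerStachPeters2017] Lemma–Definition 15.3.7, Cor. 15.3.10;
[Moonen2004MT] (5.8).
-/

noncomputable section

namespace Literature.AlgebraicGeometry.HodgeTheory

open Literature.AlgebraicGeometry.Motives Literature.LinearAlgebra.Alternating

universe u v

section IdentityComponent

variable {K : Type u} [Field K] [CharZero K] {V : Type v} [AddCommGroup V] [Module K V] [FiniteDimensional K V]
  {B : LinearMap.BilinForm K V}

/-- **`Mon⁰ ⊇ Sp(V₊) × Sp(V₋)` with fixed centres of unknown sign**: the conclusion of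
`mem_glZariskiClosure_of_signSymmetric_of_eigenCentres` inside the identity component `glIdentityComponent Γ` (a finite-index
`Γ' ≤ Γ` contains `U_r(mc)` and `U_δ(mc)U_{σδ}(mc)` for some `m ≥ 1`; the other hypotheses do not mention `Γ`).
[cite: Deligne1980, §4.4 Thm (4.4.1), (4.4.2^α)–(4.4.4^α) pp. 227–228] [cite: CarlsonMullerStachPeters2017, Lemma–Definition 15.3.7] -/
theorem mem_glIdentityComponent_of_signSymmetric_of_eigenCentres (hB : B.IsAlt) (hBn : B.Nondegenerate)
    {σ : V →ₗ[K] V} (hσ : σ ^ 2 = 1) (hσB : ∀ x y, B (σ x) (σ y) = B x y) {Γ : Subgroup (V ≃ₗ[K] V)} {T D : Set V}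
    (hT : ∀ r ∈ T, ∃ c : K, c ≠ 0 ∧ oneParamTransvectionEquiv B (hB r) c ∈ Γ)
    (hD : ∀ δ ∈ D, B δ (σ δ) = 0 ∧ ∃ c : K, c ≠ 0 ∧
      oneParamTransvectionEquiv B (hB δ) c * oneParamTransvectionEquiv B (hB (σ δ)) c ∈ Γ)
    (hTsign : ∀ r ∈ T, σ r = r ∨ σ r = -r) (hseed : D.Nonempty → T.Nonempty)
    (hspanPos : Submodule.span K ({r ∈ T | σ r = r} ∪ (fun δ => δ + σ δ) '' D) = Module.End.eigenspace σ 1)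
    (hconnPos : ∀ A ⊆ {r ∈ T | σ r = r} ∪ (fun δ => δ + σ δ) '' D, A.Nonempty →
      A ≠ {r ∈ T | σ r = r} ∪ (fun δ => δ + σ δ) '' D →
      ∃ r ∈ A, ∃ ρ ∈ {r ∈ T | σ r = r} ∪ (fun δ => δ + σ δ) '' D, ρ ∉ A ∧ B r ρ ≠ 0)
    (hspanNeg : Submodule.span K ({r ∈ T | σ r = -r} ∪ (fun δ => δ - σ δ) '' D) = Module.End.eigenspace σ (-1))
    (hconnNeg : ∀ A ⊆ {r ∈ T | σ r = -r} ∪ (fun δ => δ - σ δ) '' D, A.Nonempty →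
      A ≠ {r ∈ T | σ r = -r} ∪ (fun δ => δ - σ δ) '' D →
      ∃ r ∈ A, ∃ ρ ∈ {r ∈ T | σ r = -r} ∪ (fun δ => δ - σ δ) '' D, ρ ∉ A ∧ B r ρ ≠ 0)
    {g : V ≃ₗ[K] V} (hgσ : ∀ x, g (σ x) = σ (g x)) (hgB : ∀ x y, B (g x) (g y) = B x y) :
    g ∈ glIdentityComponent Γ := by
  rw [mem_glIdentityComponent_iff]
  intro Γ' _ hfi
  have hidx : (Γ'.subgroupOf Γ).index ≠ 0 := hfi.index_ne_zero
  refine mem_glZariskiClosure_of_signSymmetric_of_eigenCentres hB hBn hσ hσB (Γ := Γ') ?_ ?_ hTsign hseed hspanPos hconnPos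
    hspanNeg hconnNeg hgσ hgB
  · intro r hr
    obtain ⟨c, hc, hmem⟩ := hT r hr
    obtain ⟨m, hm0, -, hm⟩ := Subgroup.exists_pow_mem_of_index_ne_zero hidx (⟨_, hmem⟩ : Γ)
    rw [Subgroup.mem_subgroupOf, Subgroup.coe_pow, oneParamTransvectionEquiv_pow] at hm
    exact ⟨(m : K) * c, mul_ne_zero (Nat.cast_ne_zero.2 hm0.ne') hc, hm⟩
  · intro δ hδ
    obtain ⟨hδσ, c, hc, hmem⟩ := hD δ hδ
    obtain ⟨m, hm0, -, hm⟩ := Subgroup.exists_pow_mem_of_index_ne_zero hidx (⟨_, hmem⟩ : Γ)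
    rw [Subgroup.mem_subgroupOf, Subgroup.coe_pow, pair_oneParamTransvectionEquiv_pow hB hδσ] at hm
    exact ⟨hδσ, (m : K) * c, mul_ne_zero (Nat.cast_ne_zero.2 hm0.ne') hc, hm⟩

end IdentityComponent

section HodgeGroup

variable {V : Type u} [AddCommGroup V] [Module ℚ V] [Module.Finite ℚ V] [HodgeTensorFacts.{u, u}] {n : ℤ}

/-- **Commutators of the sign-symmetric centraliser lie in `Hg(H)(ℚ)` — fixed centres of unknown sign** (Theorem A without
Wall's sign rule + Deligne–André `Mon⁰ ⊆ MT`). [cite: Deligne1980, §4.4 Thm (4.4.1), (4.4.2^α)–(4.4.4^α) pp. 227–228]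
[cite: CarlsonMullerStachPeters2017, Lemma–Definition 15.3.7 and Corollary 15.3.10] [cite: Moonen2004MT, (5.8)] -/
theorem commutator_mem_hodgeGroup_of_signSymmetric_of_eigenCentres [Nontrivial V] (H : HodgeStructure V n)
    (hH : H.IsPolarizable) (hn : Odd n) {B : LinearMap.BilinForm ℚ V} (hB : B.IsAlt) (hBn : B.Nondegenerate)
    {σ : V →ₗ[ℚ] V} (hσ : σ ^ 2 = 1) (hσB : ∀ x y, B (σ x) (σ y) = B x y) {Γ : Subgroup (V ≃ₗ[ℚ] V)}
    (hΓ : glIdentityComponent Γ ⊆ (H.mumfordTateGroup : Set (V ≃ₗ[ℚ] V))) {T D : Set V}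
    (hT : ∀ r ∈ T, ∃ c : ℚ, c ≠ 0 ∧ oneParamTransvectionEquiv B (hB r) c ∈ Γ)
    (hD : ∀ δ ∈ D, B δ (σ δ) = 0 ∧ ∃ c : ℚ, c ≠ 0 ∧
      oneParamTransvectionEquiv B (hB δ) c * oneParamTransvectionEquiv B (hB (σ δ)) c ∈ Γ)
    (hTsign : ∀ r ∈ T, σ r = r ∨ σ r = -r) (hseed : D.Nonempty → T.Nonempty)
    (hspanPos : Submodule.span ℚ ({r ∈ T | σ r = r} ∪ (fun δ => δ + σ δ) '' D) = Module.End.eigenspace σ 1)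
    (hconnPos : ∀ A ⊆ {r ∈ T | σ r = r} ∪ (fun δ => δ + σ δ) '' D, A.Nonempty →
      A ≠ {r ∈ T | σ r = r} ∪ (fun δ => δ + σ δ) '' D →
      ∃ r ∈ A, ∃ ρ ∈ {r ∈ T | σ r = r} ∪ (fun δ => δ + σ δ) '' D, ρ ∉ A ∧ B r ρ ≠ 0)
    (hspanNeg : Submodule.span ℚ ({r ∈ T | σ r = -r} ∪ (fun δ => δ - σ δ) '' D) =
      Module.End.eigenspace σ (-1))
    (hconnNeg : ∀ A ⊆ {r ∈ T | σ r = -r} ∪ (fun δ => δ - σ δ) '' D, A.Nonempty →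
      A ≠ {r ∈ T | σ r = -r} ∪ (fun δ => δ - σ δ) '' D →
      ∃ r ∈ A, ∃ ρ ∈ {r ∈ T | σ r = -r} ∪ (fun δ => δ - σ δ) '' D, ρ ∉ A ∧ B r ρ ≠ 0)
    {g h : V ≃ₗ[ℚ] V} (hgσ : ∀ x, g (σ x) = σ (g x)) (hgB : ∀ x y, B (g x) (g y) = B x y)
    (hhσ : ∀ x, h (σ x) = σ (h x)) (hhB : ∀ x y, B (h x) (h y) = B x y) :
    g * h * g⁻¹ * h⁻¹ ∈ H.hodgeGroup :=
  commutator_mem_hodgeGroup_of_subset_mumfordTateGroup H hH hn hΓ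
    (mem_glIdentityComponent_of_signSymmetric_of_eigenCentres hB hBn hσ hσB hT hD hTsign hseed hspanPos hconnPos hspanNeg
      hconnNeg hgσ hgB)
    (mem_glIdentityComponent_of_signSymmetric_of_eigenCentres hB hBn hσ hσB hT hD hTsign hseed hspanPos hconnPos hspanNeg
      hconnNeg hhσ hhB)

end HodgeGroup

end Literature.AlgebraicGeometry.HodgeTheory

end
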